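import Summits.AtomisticToContinuum.HydrodynamicLimit.Theses.JParityClosure
import Summits.AtomisticToContinuum.HydrodynamicLimit.Theorems.JParityClosureOddContactSymmetryFluxLeGibbs
import Literature.MathematicalPhysics.KineticTheory.HardSphereCampbellAssembly
import Literature.MathematicalPhysics.KineticTheory.HardSphereEulerProofs
import Literature.MathematicalPhysics.KineticTheory.HardSphereUniformGas
import Literature.MathematicalPhysics.KineticTheory.HardSphereMeanCollisionCount
import Literature.MathematicalPhysics.KineticTheory.EnskogRateConstMarkStatics
import Literature.Analysis.FluidPDE.HardSphereTorusMeasure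
import HarnessLib

/-!
# Free insertion flux ≤ 2 × Gibbs-weighted outgoing contact flux (F2 of P4)

Crux `JParityClosure.OddContactSymmetry` (stmt-AtomisticToContinuum-17722), line `KineticSlabSketch`,
registered stub `stub_gibbsFluxLower`: under the rung-0 local Gibbs law `G` (constant profiles
`a ≡ 1`, `u ≡ 0`, `θ`; reduced density `σ ≤ 1/4`, `N ≥ 1`) the free-insertion contact flux
`Σ_{i≠j} E_G[∫ dω ε² (ω·(vᵢ−vⱼ))₊]` is at most twice the outgoing collision flux of the canonical
density, `2 · outgoingCollisionFlux ε (N+1) ρ`.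

Proof, termwise in the ordered pair `i ≠ j`.  At the inserted configuration `w = zⁱʲ_ω` (particle `i`
re-placed at contact with `j`, velocities kept) the canonical weight satisfies the LOWER bound
`ρ(w) ≥ ρ(z) · 𝟙{xⱼ + εω is ε-clear of every x_k, k ≠ i}` (the constraints not involving `i` are those
of `z`, the Maxwellian factor only sees the velocities), so the `(i, j)` flux term dominates
`E_G[∫ dω ε² (ω·(vᵢ−vⱼ))₊ 𝟙_clear]`.  Under the rung-0 product structure (positions canonical
hard-sphere `P`, velocities i.i.d. Maxwellian) this expectation factorises for each direction `ω` as
`P(clear_ω) · E[ε² (ω·(vᵢ−vⱼ))₊]`, and `P(clear_ω) ≥ 1/2`: the failure of clearance is covered by the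
`N − 1` pair events `{x_k − x_j ∈ B_ε(εω)}`, `k ∉ {i, j}` (the pair `(i, j)` itself sits at distance
exactly `ε`), each of canonical probability `≤ 5 |B_ε|` (`posGibbs_pairEvent_le_five`, Ruelle's
free-volume bound), and `5 N |B_ε| ≤ 1/2` for `σ ≤ 1/4`.
-/

noncomputable section

open scoped BigOperators Classical InnerProductSpace ENNReal Topology
open Set MeasureTheory Filter
open Literature.Analysis.FluidPDE Literature.MathematicalPhysics.KineticTheory

namespace Summit.AtomisticToContinuum.HydrodynamicLimit.Theorems.OddContactSymmetryKineticSlab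

/-! ### Smallness of the excluded volume -/

/-- **Smallness at `σ ≤ 1/4`.** `5 N |B_{ε_N}| ≤ 1/2` for `ε_N = σ (N+1)^{-1/3}`:
`5 N ε_N³ (4π/3) ≤ 5 σ³ · 16/3 ≤ 5/12`. [folklore] -/
theorem five_mul_natCast_mul_volume_ball_le {σ : ℝ} (hσ : 0 < σ) (hσ4 : σ ≤ 1 / 4) (N : ℕ) :
    5 * ((N : ℝ≥0∞) * volume (Metric.ball (0 : V3) (hsDiameter σ N))) ≤ 2⁻¹ := by
  have hε0 : 0 ≤ hsDiameter σ N := (hsDiameter_pos hσ N).le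
  have h3 := succ_mul_hsDiameter_pow_three σ N
  have hσ3 : σ ^ 3 ≤ (1 / 4) ^ 3 := pow_le_pow_left₀ hσ.le hσ4 3
  have hN : (N : ℝ) * hsDiameter σ N ^ 3 ≤ σ ^ 3 := by
    rw [← h3]
    exact mul_le_mul_of_nonneg_right (by exact_mod_cast N.le_succ) (pow_nonneg hε0 3)
  have hreal : 5 * ((N : ℝ) * (hsDiameter σ N ^ 3 * (Real.pi * 4 / 3))) ≤ 1 / 2 := by
    have hπ := Real.pi_le_four
    have hπ0 := Real.pi_pos.le
    nlinarith [mul_nonneg (Nat.cast_nonneg N) (pow_nonneg hε0 3)]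
  rw [EuclideanSpace.volume_ball_fin_three, ← ENNReal.ofReal_pow hε0,
    ← ENNReal.ofReal_mul (pow_nonneg hε0 3), ← ENNReal.ofReal_natCast,
    ← ENNReal.ofReal_mul (Nat.cast_nonneg N), ← ENNReal.ofReal_ofNat 5,
    ← ENNReal.ofReal_mul (by norm_num : (0 : ℝ) ≤ 5),
    show (2⁻¹ : ℝ≥0∞) = ENNReal.ofReal (1 / 2) by
      rw [ENNReal.ofReal_div_of_pos two_pos, ENNReal.ofReal_one, ENNReal.ofReal_ofNat, one_div]]
  exact ENNReal.ofReal_le_ofReal hreal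

/-! ### Clearance of the inserted sphere under the canonical position law -/

/-- **The inserted sphere is clear with probability `≥ 1/2`.** Under the configurational Gibbs
measure of `N + 1` hard spheres of diameter `ε = ε_N` (`σ ≤ 1/4`, `N ≥ 1`), for a unit vector `ω`
and `i ≠ j`, the point `xⱼ + εω` is at minimal-image distance `≥ ε` from every `x_k`, `k ≠ i`,
with probability at least `1/2`: the pair `k = j` is at distance exactly `ε`, and each of the
`N − 1` events `dist(xⱼ + εω, x_k) < ε`, `k ∉ {i, j}`, is a pair event `x_k − xⱼ ∈ B` with
`|B| = |B_ε|`, of probability `≤ 5 |B_ε|` (`posGibbs_pairEvent_le_five`). [folklore] -/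
theorem one_le_two_mul_posGibbs_clear {σ : ℝ} (hσ : 0 < σ) (hσ4 : σ ≤ 1 / 4) {N : ℕ} (hN : 1 ≤ N)
    {i j : Fin (N + 1)} (hij : i ≠ j) {ω : V3} (hω : ‖ω‖ = 1) :
    1 ≤ 2 * posGibbsMeasure (fun _ : T3 => (1 : ℝ)) (hsDiameter σ N) (N + 1)
      {xs | ∀ k, k ≠ i → hsDiameter σ N ≤ Torus.euclidDist
        (xs j + Literature.Analysis.FunctionSpaces.Torus.proj (hsDiameter σ N • ω)) (xs k)} := by
  have hσ2 : σ ≤ 1 / 2 := hσ4.trans (by norm_num)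
  set ε := hsDiameter σ N with hε
  set p : T3 := Literature.Analysis.FunctionSpaces.Torus.proj (ε • ω) with hp
  set P := posGibbsMeasure (fun _ : T3 => (1 : ℝ)) ε (N + 1) with hP
  haveI : IsProbabilityMeasure P :=
    isProbabilityMeasure_posGibbsMeasure continuous_const (fun _ => one_pos) hσ2 N
  set S : Set (Fin (N + 1) → T3) := {xs | ∀ k, k ≠ i → ε ≤ Torus.euclidDist (xs j + p) (xs k)}
    with hS
  set T : Set T3 := {q | Torus.euclidDist q p < ε} with hT
  have hε0 : 0 ≤ ε := (hsDiameter_pos hσ N).le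
  have hεhalf : ε < 1 / 2 := (hsDiameter_le hσ.le N).trans_lt (by linarith)
  have hTm : MeasurableSet T :=
    measurableSet_lt ((Torus.measurable_geometry_sepVec (d := Fin 3)).comp
      (measurable_id.prodMk measurable_const)).norm measurable_const
  have hTvol : volume T = volume (Metric.ball (0 : V3) ε) := Torus.volume_euclidDist_lt hεhalf p
  -- the pair `(i, j)` itself is at distance exactly `ε`
  have hjj : ∀ xs : Fin (N + 1) → T3, Torus.euclidDist (xs j + p) (xs j) = ε := by
    intro xs
    have h := norm_sepVec_contactInsert hε0 hεhalf hij hω (zipConfig (xs, fun _ => (0 : V3)))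
    rwa [contactInsert_apply_self, contactInsert_apply_of_ne ε j ω _ hij.symm] at h
  -- the failure of clearance is covered by the pair events `x_k - x_j ∈ T`, `k ∉ {i, j}`
  have hcover : Sᶜ ⊆ ⋃ k ∈ ((Finset.univ : Finset (Fin (N + 1))).erase i).erase j,
      {xs : Fin (N + 1) → T3 | xs k - xs j ∈ T} := by
    intro xs hxs
    simp only [hS, mem_compl_iff, mem_setOf_eq, not_forall, not_le, exists_prop] at hxs
    obtain ⟨k, hki, hlt⟩ := hxs
    have hkj : k ≠ j := by
      rintro rfl
      rw [hjj] at hlt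
      exact lt_irrefl _ hlt
    refine mem_biUnion (Finset.mem_erase.2 ⟨hkj, Finset.mem_erase.2 ⟨hki, Finset.mem_univ k⟩⟩) ?_
    have hrel : Torus.euclidDist (xs k - xs j) p = Torus.euclidDist (xs j + p) (xs k) := by
      rw [Torus.euclidDist_comm (xs j + p), Torus.euclidDist_eq, Torus.euclidDist_eq,
        sub_add_eq_sub_sub]
    show Torus.euclidDist (xs k - xs j) p < ε
    rw [hrel]
    exact hlt
  have hcompl : P Sᶜ ≤ 2⁻¹ := by
    refine (measure_mono hcover).trans ((measure_biUnion_finset_le _ _).trans ?_)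
    calc ∑ k ∈ ((Finset.univ : Finset (Fin (N + 1))).erase i).erase j, P {xs | xs k - xs j ∈ T}
        ≤ ∑ _k ∈ ((Finset.univ : Finset (Fin (N + 1))).erase i).erase j,
            5 * volume (Metric.ball (0 : V3) ε) := by
          refine Finset.sum_le_sum fun k hk => ?_
          rw [← hTvol]
          exact posGibbs_pairEvent_le_five hσ.le hσ2 hN (Finset.mem_erase.1 hk).1 hTm
      _ ≤ (N : ℝ≥0∞) * (5 * volume (Metric.ball (0 : V3) ε)) := by
          rw [Finset.sum_const, nsmul_eq_mul]
          refine mul_le_mul' ?_ le_rfl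
          have hcard : ((((Finset.univ : Finset (Fin (N + 1))).erase i).erase j).card : ℕ) ≤ N := by
            calc _ ≤ ((Finset.univ : Finset (Fin (N + 1))).erase i).card := Finset.card_erase_le
              _ = N := by
                rw [Finset.card_erase_of_mem (Finset.mem_univ i), Finset.card_univ, Fintype.card_fin,
                  Nat.add_sub_cancel]
          exact_mod_cast hcard
      _ = 5 * ((N : ℝ≥0∞) * volume (Metric.ball (0 : V3) ε)) := by ring
      _ ≤ 2⁻¹ := five_mul_natCast_mul_volume_ball_le hσ hσ4 N
  have hone : (1 : ℝ≥0∞) ≤ P S + 2⁻¹ := by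
    calc (1 : ℝ≥0∞) = P univ := measure_univ.symm
      _ = P (S ∪ Sᶜ) := by rw [union_compl_self]
      _ ≤ P S + P Sᶜ := measure_union_le _ _
      _ ≤ P S + 2⁻¹ := add_le_add le_rfl hcompl
  have hhalf : (2⁻¹ : ℝ≥0∞) ≤ P S := by
    rw [← ENNReal.inv_two_add_inv_two] at hone
    exact (ENNReal.add_le_add_iff_right (by simp)).1 hone
  calc (1 : ℝ≥0∞) = 2 * 2⁻¹ := (ENNReal.mul_inv_cancel two_ne_zero ENNReal.ofNat_ne_top).symm
    _ ≤ 2 * P S := mul_le_mul' le_rfl hhalf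

/-! ### The canonical weight at the inserted configuration: lower bound -/

/-- **Pointwise lower bound at the inserted configuration.** If `xⱼ + εω` is `ε`-clear of every
`x_k`, `k ≠ i`, then the hard-core-restricted canonical weight at `w = zⁱʲ_ω` dominates the weight
at `z`: `ρ(z) K ≤ K 𝟙_D(w) ρ(w)` (`w = z` off `i`, so `z ∈ D ⇒ w ∈ D`, and the rung-0 Maxwellian
factor only sees the velocities, which are kept). [folklore] -/
theorem ofReal_canonicalDensity_mul_le_fluxWeight (θ ε : ℝ) {N : ℕ} {i j : Fin (N + 1)} (ω : V3)
    {z : Config (N + 1) (Fin 3) T3}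
    (hC : ∀ k, k ≠ i → ε ≤ ‖(Torus.geometry (Fin 3)).sepVec
      ((contactInsert ε i j ω z) i).1 (z k).1‖) (Kv : ℝ≥0∞) :
    ENNReal.ofReal (canonicalDensity (Torus.geometry (Fin 3)) ε (N + 1)
        (localGibbsProfile (fun _ => 1) (fun _ => 0) (fun _ => θ)) z) * Kv ≤
      Kv * (hardSphereDomain (Torus.geometry (Fin 3)) (N + 1) ε).indicator
        (fun w => ENNReal.ofReal (canonicalDensity (Torus.geometry (Fin 3)) ε (N + 1)
          (localGibbsProfile (fun _ => 1) (fun _ => 0) (fun _ => θ)) w))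
        (contactInsert ε i j ω z) := by
  by_cases hzD : z ∈ hardSphereDomain (Torus.geometry (Fin 3)) (N + 1) ε
  · -- the inserted configuration is in the hard-sphere domain
    have hwD : contactInsert ε i j ω z ∈ hardSphereDomain (Torus.geometry (Fin 3)) (N + 1) ε := by
      intro k l hkl
      by_cases hki : k = i
      · rw [hki] at hkl ⊢
        rw [contactInsert_apply_of_ne ε j ω z (Ne.symm hkl)]
        exact hC l (Ne.symm hkl)
      · by_cases hli : l = i
        · rw [hli, contactInsert_apply_of_ne ε j ω z hki, Torus.norm_geometry_sepVec,
            Torus.euclidDist_comm, ← Torus.norm_geometry_sepVec]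
          exact hC k hki
        · rw [contactInsert_apply_of_ne ε j ω z hki, contactInsert_apply_of_ne ε j ω z hli]
          exact hzD k l hkl
    have hρw : canonicalDensity (Torus.geometry (Fin 3)) ε (N + 1)
        (localGibbsProfile (fun _ => 1) (fun _ => 0) (fun _ => θ)) (contactInsert ε i j ω z) =
        canonicalDensity (Torus.geometry (Fin 3)) ε (N + 1)
          (localGibbsProfile (fun _ => 1) (fun _ => 0) (fun _ => θ)) z := by
      simp only [canonicalDensity]
      rw [indicator_of_mem hwD, indicator_of_mem hzD,
        tensorPow_rung0_eq_of_vel_eq θ (contactInsert_vel ε i j ω z)]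
    rw [indicator_of_mem hwD, hρw, mul_comm]
  · rw [canonicalDensity_eq_zero_of_notMem _ _ _ _ hzD, ENNReal.ofReal_zero, zero_mul]
    exact zero_le

/-! ### The bound for one ordered pair -/

/-- **One ordered pair.** For `i ≠ j`, the local-Gibbs expectation of the free insertion integral
`∫ dω ε² (ω·(vᵢ−vⱼ))₊` is at most twice the `(i, j)` term of the outgoing collision flux of the
canonical density: lower the flux integrand to `ρ(z) ε² (ω·(vᵢ−vⱼ))₊ 𝟙_clear`
(`ofReal_canonicalDensity_mul_le_fluxWeight`), factorise under the rung-0 product structure for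
each direction (`lintegral_localGibbsLaw_rung0`), and use `P(clear) ≥ 1/2`
(`one_le_two_mul_posGibbs_clear`). [folklore] -/
theorem gibbsFluxTerm_le {σ : ℝ} (hσ : 0 < σ) (hσ4 : σ ≤ 1 / 4) {θ : ℝ} (hθ : 0 < θ) {N : ℕ}
    (hN : 1 ≤ N) (Φ : HardSphereFlow (Torus.geometry (Fin 3)) (hsDiameter σ N) (N + 1))
    {i j : Fin (N + 1)} (hij : i ≠ j) :
    ∫⁻ z, ∫⁻ ω : Metric.sphere (0 : V3) 1,
        ENNReal.ofReal (hsDiameter σ N ^ 2 * ⟪((ω : V3)), (z i).2 - (z j).2⟫_ℝ)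
        ∂(volume : Measure V3).toSphere
      ∂(localGibbsLaw σ (fun _ => 1) (fun _ => 0) (fun _ => θ) N Φ) ≤
    2 * ∫⁻ z, ∫⁻ ω : Metric.sphere (0 : V3) 1,
        ENNReal.ofReal (hsDiameter σ N ^ 2 * ⟪((ω : V3)), (z i).2 - (z j).2⟫_ℝ) *
          (hardSphereDomain (Torus.geometry (Fin 3)) (N + 1) (hsDiameter σ N)).indicator
            (fun w => ENNReal.ofReal (canonicalDensity (Torus.geometry (Fin 3)) (hsDiameter σ N) (N + 1)
              (localGibbsProfile (fun _ => 1) (fun _ => 0) (fun _ => θ)) w))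
            (contactInsert (hsDiameter σ N) i j (ω : V3) z)
        ∂(volume : Measure V3).toSphere := by
  haveI hSF : SFinite ((volume : Measure V3).toSphere) := inferInstance
  have hσ2 : σ ≤ 1 / 2 := hσ4.trans (by norm_num)
  haveI : IsProbabilityMeasure (localGibbsLaw σ (fun _ => 1) (fun _ => 0) (fun _ => θ) N Φ) :=
    isProbabilityMeasure_localGibbsLaw continuous_const continuous_const continuous_const
      (fun _ => one_pos) (fun _ => hθ) hσ2 N Φ
  haveI : IsProbabilityMeasure (posGibbsMeasure (fun _ : T3 => (1 : ℝ)) (hsDiameter σ N) (N + 1)) :=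
    isProbabilityMeasure_posGibbsMeasure continuous_const (fun _ => one_pos) hσ2 N
  -- the flux weight and the clearance event, as functions of (configuration, direction)
  set Wf : Config (N + 1) (Fin 3) T3 × Metric.sphere (0 : V3) 1 → ℝ≥0∞ := fun p =>
    ENNReal.ofReal (hsDiameter σ N ^ 2 * ⟪((p.2 : V3)), (p.1 i).2 - (p.1 j).2⟫_ℝ) with hWf
  set E : Set (Config (N + 1) (Fin 3) T3 × Metric.sphere (0 : V3) 1) := {p | ∀ k, k ≠ i →
    hsDiameter σ N ≤ ‖(Torus.geometry (Fin 3)).sepVec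
      ((contactInsert (hsDiameter σ N) i j (p.2 : V3) p.1) i).1 (p.1 k).1‖} with hE
  -- the clearance event on positions, per direction
  set Cpos : Metric.sphere (0 : V3) 1 → Set (Fin (N + 1) → T3) := fun ω =>
    {xs | ∀ k, k ≠ i → hsDiameter σ N ≤ Torus.euclidDist
      (xs j + Literature.Analysis.FunctionSpaces.Torus.proj (hsDiameter σ N • (ω : V3))) (xs k)}
    with hCpos
  -- measurability
  have hv : ∀ k : Fin (N + 1), Measurable fun p : Config (N + 1) (Fin 3) T3 × Metric.sphere (0 : V3) 1 =>
      (p.1 k).2 := fun k => measurable_snd.comp ((measurable_pi_apply k).comp measurable_fst)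
  have hWm : Measurable Wf :=
    (measurable_const.mul ((measurable_subtype_coe.comp measurable_snd).inner
      ((hv i).sub (hv j)))).ennreal_ofReal
  have hEm : MeasurableSet E := by
    refine measurableSet_setOf.2 (Measurable.forall fun k => measurable_const.imp ?_)
    exact measurableSet_setOf.1 (measurableSet_le measurable_const
      ((Torus.measurable_geometry_sepVec.comp
        ((measurable_fst.comp ((measurable_pi_apply i).comp
          (measurable_contactInsert_prod (hsDiameter σ N) i j))).prodMk
          (measurable_fst.comp ((measurable_pi_apply k).comp measurable_fst)))).norm))
  have hWEm : Measurable fun p => Wf p * E.indicator 1 p := hWm.mul (measurable_one.indicator hEm)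
  have hW₀m : ∀ ω : Metric.sphere (0 : V3) 1, Measurable fun vs : Fin (N + 1) → V3 =>
      ENNReal.ofReal (hsDiameter σ N ^ 2 * ⟪((ω : V3)), vs i - vs j⟫_ℝ) := fun ω =>
    (measurable_const.mul (((measurable_pi_apply i).sub (measurable_pi_apply j)).const_inner)).ennreal_ofReal
  -- the clearance event read on a zipped configuration
  have hmemE : ∀ (ω : Metric.sphere (0 : V3) 1) (xs : Fin (N + 1) → T3) (vs : Fin (N + 1) → V3),
      (zipConfig (xs, vs), ω) ∈ E ↔ xs ∈ Cpos ω := by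
    intro ω xs vs
    simp only [hE, hCpos, mem_setOf_eq, contactInsert_apply_self, zipConfig_apply,
      Torus.norm_geometry_sepVec]
  have hCm : ∀ ω : Metric.sphere (0 : V3) 1, MeasurableSet (Cpos ω) := fun ω => by
    have h : MeasurableSet ((fun xs : Fin (N + 1) → T3 =>
        (zipConfig (xs, fun _ : Fin (N + 1) => (0 : V3)), ω)) ⁻¹' E) :=
      hEm.preimage ((measurable_zipConfig.comp (measurable_id.prodMk measurable_const)).prodMk
        measurable_const)
    convert h using 1
    ext xs
    exact (hmemE ω xs _).symm
  have hind : ∀ (ω : Metric.sphere (0 : V3) 1) (xs : Fin (N + 1) → T3) (vs : Fin (N + 1) → V3),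
      E.indicator (1 : Config (N + 1) (Fin 3) T3 × Metric.sphere (0 : V3) 1 → ℝ≥0∞) (zipConfig (xs, vs), ω) =
        (Cpos ω).indicator (1 : (Fin (N + 1) → T3) → ℝ≥0∞) xs := by
    intro ω xs vs
    by_cases hxs : xs ∈ Cpos ω
    · rw [indicator_of_mem hxs, indicator_of_mem ((hmemE ω xs vs).2 hxs)]
      rfl
    · rw [indicator_of_notMem hxs, indicator_of_notMem (mt (hmemE ω xs vs).1 hxs)]
  -- rung-0 factorisation, per direction
  have hinnerL : ∀ ω : Metric.sphere (0 : V3) 1,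
      ∫⁻ z, Wf (z, ω) ∂(localGibbsLaw σ (fun _ => 1) (fun _ => 0) (fun _ => θ) N Φ) =
        ∫⁻ vs, ENNReal.ofReal (hsDiameter σ N ^ 2 * ⟪((ω : V3)), vs i - vs j⟫_ℝ)
          ∂(Measure.pi fun _ : Fin (N + 1) => gaussMeasure (0 : V3) θ) := by
    intro ω
    rw [lintegral_localGibbsLaw_rung0 σ zero_le_one hθ (0 : V3) N Φ (F := fun z => Wf (z, ω))
      (hWm.comp measurable_prodMk_right)]
    simp only [hWf, zipConfig_apply]
    rw [lintegral_const, measure_univ, mul_one]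
  have hinnerH : ∀ ω : Metric.sphere (0 : V3) 1,
      ∫⁻ z, Wf (z, ω) * E.indicator 1 (z, ω)
        ∂(localGibbsLaw σ (fun _ => 1) (fun _ => 0) (fun _ => θ) N Φ) =
        posGibbsMeasure (fun _ : T3 => (1 : ℝ)) (hsDiameter σ N) (N + 1) (Cpos ω) *
          ∫⁻ vs, ENNReal.ofReal (hsDiameter σ N ^ 2 * ⟪((ω : V3)), vs i - vs j⟫_ℝ)
            ∂(Measure.pi fun _ : Fin (N + 1) => gaussMeasure (0 : V3) θ) := by
    intro ω
    rw [lintegral_localGibbsLaw_rung0 σ zero_le_one hθ (0 : V3) N Φ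
      (F := fun z => Wf (z, ω) * E.indicator 1 (z, ω)) (hWEm.comp measurable_prodMk_right)]
    simp_rw [hind ω]
    simp only [hWf, zipConfig_apply]
    simp_rw [lintegral_mul_const _ (hW₀m ω)]
    rw [lintegral_const_mul _ (measurable_one.indicator (hCm ω)), lintegral_indicator_one (hCm ω)]
    exact mul_comm _ _
  -- Tonelli: the direction outermost
  have hL : ∫⁻ z, ∫⁻ ω, Wf (z, ω) ∂(volume : Measure V3).toSphere
      ∂(localGibbsLaw σ (fun _ => 1) (fun _ => 0) (fun _ => θ) N Φ) =
      ∫⁻ ω, ∫⁻ z, Wf (z, ω) ∂(localGibbsLaw σ (fun _ => 1) (fun _ => 0) (fun _ => θ) N Φ)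
        ∂(volume : Measure V3).toSphere :=
    lintegral_lintegral_swap hWm.aemeasurable
  have hH : ∫⁻ z, ∫⁻ ω, Wf (z, ω) * E.indicator 1 (z, ω) ∂(volume : Measure V3).toSphere
      ∂(localGibbsLaw σ (fun _ => 1) (fun _ => 0) (fun _ => θ) N Φ) =
      ∫⁻ ω, ∫⁻ z, Wf (z, ω) * E.indicator 1 (z, ω)
        ∂(localGibbsLaw σ (fun _ => 1) (fun _ => 0) (fun _ => θ) N Φ) ∂(volume : Measure V3).toSphere :=
    lintegral_lintegral_swap hWEm.aemeasurable
  -- the key comparison under the local Gibbs law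
  have hkey : ∫⁻ z, ∫⁻ ω, Wf (z, ω) ∂(volume : Measure V3).toSphere
      ∂(localGibbsLaw σ (fun _ => 1) (fun _ => 0) (fun _ => θ) N Φ) ≤
      2 * ∫⁻ z, ∫⁻ ω, Wf (z, ω) * E.indicator 1 (z, ω) ∂(volume : Measure V3).toSphere
        ∂(localGibbsLaw σ (fun _ => 1) (fun _ => 0) (fun _ => θ) N Φ) := by
    rw [hL, hH, ← lintegral_const_mul' (2 : ℝ≥0∞) _ ENNReal.ofNat_ne_top]
    refine lintegral_mono fun ω => ?_
    rw [hinnerL ω, hinnerH ω, ← mul_assoc]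
    have hω : ‖(ω : V3)‖ = 1 := mem_sphere_zero_iff_norm.1 ω.2
    exact le_mul_of_one_le_left zero_le (one_le_two_mul_posGibbs_clear hσ hσ4 hN hij hω)
  -- back to the Liouville measure through the canonical density
  have hρm : Measurable fun z : Config (N + 1) (Fin 3) T3 =>
      ENNReal.ofReal (canonicalDensity (Torus.geometry (Fin 3)) (hsDiameter σ N) (N + 1)
        (localGibbsProfile (fun _ => 1) (fun _ => 0) (fun _ => θ)) z) :=
    (measurable_canonicalDensity _ _
      (measurable_localGibbsProfile continuous_const continuous_const continuous_const)).ennreal_ofReal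
  calc ∫⁻ z, ∫⁻ ω, Wf (z, ω) ∂(volume : Measure V3).toSphere
        ∂(localGibbsLaw σ (fun _ => 1) (fun _ => 0) (fun _ => θ) N Φ)
      ≤ 2 * ∫⁻ z, ∫⁻ ω, Wf (z, ω) * E.indicator 1 (z, ω) ∂(volume : Measure V3).toSphere
          ∂(localGibbsLaw σ (fun _ => 1) (fun _ => 0) (fun _ => θ) N Φ) := hkey
    _ = 2 * ∫⁻ z, ENNReal.ofReal (canonicalDensity (Torus.geometry (Fin 3)) (hsDiameter σ N) (N + 1)
            (localGibbsProfile (fun _ => 1) (fun _ => 0) (fun _ => θ)) z) *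
          ∫⁻ ω, Wf (z, ω) * E.indicator 1 (z, ω) ∂(volume : Measure V3).toSphere := by
        rw [localGibbsLaw_eq, localGibbsMeasure,
          lintegral_withDensity_eq_lintegral_mul_non_measurable _ hρm
            (ae_of_all _ fun _ => ENNReal.ofReal_lt_top)]
        rfl
    _ ≤ 2 * ∫⁻ z, ∫⁻ ω : Metric.sphere (0 : V3) 1, Wf (z, ω) *
          (hardSphereDomain (Torus.geometry (Fin 3)) (N + 1) (hsDiameter σ N)).indicator
            (fun w => ENNReal.ofReal (canonicalDensity (Torus.geometry (Fin 3)) (hsDiameter σ N) (N + 1)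
              (localGibbsProfile (fun _ => 1) (fun _ => 0) (fun _ => θ)) w))
            (contactInsert (hsDiameter σ N) i j (ω : V3) z) ∂(volume : Measure V3).toSphere := by
        refine mul_le_mul' le_rfl (lintegral_mono fun z => ?_)
        rw [← lintegral_const_mul' _ _ ENNReal.ofReal_ne_top]
        refine lintegral_mono fun ω => ?_
        by_cases hzE : (z, ω) ∈ E
        · have hC : ∀ k, k ≠ i → hsDiameter σ N ≤ ‖(Torus.geometry (Fin 3)).sepVec
              ((contactInsert (hsDiameter σ N) i j (ω : V3) z) i).1 (z k).1‖ := hzE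
          rw [indicator_of_mem hzE, Pi.one_apply, mul_one]
          exact ofReal_canonicalDensity_mul_le_fluxWeight θ (hsDiameter σ N) (ω : V3) hC (Wf (z, ω))
        · rw [indicator_of_notMem hzE, mul_zero, mul_zero]
          exact zero_le

/-- **Registered stub `stub_gibbsFluxLower` (F2 of P4, line `KineticSlabSketch` of crux
`JParityClosure.OddContactSymmetry`).** Under the rung-0 local Gibbs law at reduced density
`σ ≤ 1/4` (`N ≥ 1`), the free-insertion contact flux is at most twice the Gibbs-weighted outgoing
contact flux: termwise in the ordered pair (`gibbsFluxTerm_le`). [folklore] -/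
theorem stub_gibbsFluxLower :
    ∀ {σ : ℝ} (_hσ : 0 < σ) (_hσ4 : σ ≤ 1 / 4) {θ : ℝ} (_hθ : 0 < θ) {N : ℕ} (_hN : 1 ≤ N)
    (Φ : HardSphereFlow (Torus.geometry (Fin 3)) (hsDiameter σ N) (N + 1)),
    (∑ i : Fin (N + 1), ∑ j : Fin (N + 1), if i = j then 0 else
        ∫⁻ z, ∫⁻ ω : Metric.sphere (0 : V3) 1,
            ENNReal.ofReal (hsDiameter σ N ^ 2 * ⟪((ω : V3)), (z i).2 - (z j).2⟫_ℝ)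
          ∂(volume : Measure V3).toSphere
        ∂(localGibbsLaw σ (fun _ => 1) (fun _ => 0) (fun _ => θ) N Φ)) ≤
      2 * outgoingCollisionFlux (hsDiameter σ N) (N + 1)
        (fun w _ _ => ENNReal.ofReal (canonicalDensity (Torus.geometry (Fin 3)) (hsDiameter σ N) (N + 1)
          (localGibbsProfile (fun _ => 1) (fun _ => 0) (fun _ => θ)) w)) := by
  intro σ hσ hσ4 θ hθ N hN Φ
  have hcard : Fintype.card (Fin 3) - 1 = 2 := by simp
  unfold outgoingCollisionFlux
  simp only [hcard]
  rw [Finset.mul_sum]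
  refine Finset.sum_le_sum fun i _ => ?_
  rw [Finset.mul_sum]
  refine Finset.sum_le_sum fun j _ => ?_
  split_ifs with hij
  · simp
  · exact gibbsFluxTerm_le hσ hσ4 hθ hN Φ hij

end Summit.AtomisticToContinuum.HydrodynamicLimit.Theorems.OddContactSymmetryKineticSlab

end
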